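import Mathlib

/-!
# Route LevelSetModeration — crux `LevelSetClosure`: level-set tools (helper file)

Support lemmas for item stmt-NavierStokesRegularity-18150 (line `Sketch-ideator2`, De Giorgi volume
bookkeeping `V(c) = ∫⁻ τ ∈ (0,T), vol{c < |u τ|}` for the speed of a Navier–Stokes solution):

* `tools_supLimit` — monotone limit in the upper time limit of a lower Lebesgue integral over
  `(0,t)`, `t ↑ T`: if `∫⁻ τ ∈ (0,t), f ≤ r` for every `t ∈ [0,T)` then `∫⁻ τ ∈ (0,T), f ≤ r`
  (no measurability of `f` is needed: the outer integral is continuous from below along a directed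
  countable exhaustion, `MeasureTheory.setLIntegral_iUnion_of_directed`);
* `tools_openNullEmpty` — OPEN-NULL-EMPTY: a jointly continuous field on `[0,T) × ℝ³` whose
  super-level set `{|u| > M}` has zero space–time volume never exceeds `M` on `(0,T)`;
* `tools_zeroExcess` — ZERO-EXCESS: a continuous slice with `∫ (|v| - c)₊² ≤ 0` never exceeds `c`;
* `stub_levelSetTools` — the registered conjunction of the three tools.
-/

noncomputable section

-- single-conjunct summit: `Summit.<Summit>.<Problem>` repeats the name by the D-0017 layout
set_option linter.dupNamespace false

namespace Summit.NavierStokesRegularity.NavierStokesRegularity.Theorems.LevelSetClosure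

open MeasureTheory Set Filter Topology Function
open scoped ENNReal NNReal

/-- **Tool (a): monotone limit in the upper time limit.** If `∫⁻ τ ∈ (0,t), f τ ≤ r` for every
`t ∈ [0,T)`, then `∫⁻ τ ∈ (0,T), f τ ≤ r`. No measurability of `f` is required: `(0,T)` is the
directed countable union of the intervals `(0,q)`, `q` rational in `[0,T)`, and the lower Lebesgue
integral over a directed countable union is the supremum of the integrals over the pieces. -/
theorem tools_supLimit :
    ∀ (f : ℝ → ℝ≥0∞) (T : ℝ) (r : ℝ≥0∞), 0 < T →
      (∀ t ∈ Set.Ico 0 T, ∫⁻ τ in Set.Ioo 0 t, f τ ≤ r) → ∫⁻ τ in Set.Ioo 0 T, f τ ≤ r := by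
  intro f T r _ h
  -- the directed countable exhaustion of `(0,T)` by `(0,q)`, `q ∈ ℚ ∩ [0,T)`
  have hdir : Directed (· ⊆ ·)
      (fun q : {q : ℚ // 0 ≤ (q : ℝ) ∧ (q : ℝ) < T} => Set.Ioo (0 : ℝ) (q.1 : ℝ)) := by
    refine directed_of_isDirected_le fun i j hij => Set.Ioo_subset_Ioo_right ?_
    exact_mod_cast (show (i : ℚ) ≤ j from hij)
  have hsub : Set.Ioo 0 T ⊆
      ⋃ q : {q : ℚ // 0 ≤ (q : ℝ) ∧ (q : ℝ) < T}, Set.Ioo (0 : ℝ) (q.1 : ℝ) := by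
    intro τ hτ
    obtain ⟨q, hτq, hqT⟩ := exists_rat_btwn hτ.2
    exact Set.mem_iUnion.2 ⟨⟨q, (hτ.1.trans hτq).le, hqT⟩, hτ.1, hτq⟩
  calc ∫⁻ τ in Set.Ioo 0 T, f τ
      ≤ ∫⁻ τ in ⋃ q : {q : ℚ // 0 ≤ (q : ℝ) ∧ (q : ℝ) < T}, Set.Ioo (0 : ℝ) (q.1 : ℝ), f τ :=
        lintegral_mono_set hsub
    _ = ⨆ q : {q : ℚ // 0 ≤ (q : ℝ) ∧ (q : ℝ) < T}, ∫⁻ τ in Set.Ioo (0 : ℝ) (q.1 : ℝ), f τ :=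
        setLIntegral_iUnion_of_directed f hdir
    _ ≤ r := iSup_le fun q => h _ ⟨q.2.1, q.2.2⟩

/-- **Tool (b): OPEN-NULL-EMPTY.** If `u` is jointly continuous on `[0,T) × ℝ³` and the space–time
volume `∫⁻ τ ∈ (0,T), vol{x | M < ‖u τ x‖}` of the super-level set vanishes, then `‖u t x‖ ≤ M` for
every `t ∈ (0,T)` and every `x`: otherwise joint continuity at the interior point `(t,x)` produces a
product of balls inside the (open) super-level set, of positive space–time volume. -/
theorem tools_openNullEmpty :
    ∀ (T M : ℝ) (u : ℝ → EuclideanSpace ℝ (Fin 3) → EuclideanSpace ℝ (Fin 3)),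
      ContinuousOn (Function.uncurry u) (Set.Ico 0 T ×ˢ Set.univ) →
      (∫⁻ τ in Set.Ioo 0 T, volume {x | M < ‖u τ x‖}) = 0 →
      ∀ t ∈ Set.Ioo 0 T, ∀ x, ‖u t x‖ ≤ M := by
  intro T M u hu hV t ht x
  refine le_of_not_gt fun hlt => ?_
  -- `(t, x)` is an interior point of `[0,T) × ℝ³`, so `u` is jointly continuous there
  have hIoo : Set.Ioo 0 T ×ˢ (Set.univ : Set (EuclideanSpace ℝ (Fin 3))) ∈ 𝓝 (t, x) :=
    prod_mem_nhds (Ioo_mem_nhds ht.1 ht.2) univ_mem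
  have hcont : ContinuousAt (Function.uncurry u) (t, x) :=
    hu.continuousAt (mem_of_superset hIoo (Set.prod_mono Set.Ioo_subset_Ico_self le_rfl))
  have hopen : IsOpen {z : EuclideanSpace ℝ (Fin 3) | M < ‖z‖} :=
    isOpen_lt continuous_const continuous_norm
  have hpre : Function.uncurry u ⁻¹' {z | M < ‖z‖} ∩ Set.Ioo 0 T ×ˢ Set.univ ∈ 𝓝 (t, x) :=
    inter_mem (hcont.preimage_mem_nhds (hopen.mem_nhds hlt)) hIoo
  obtain ⟨ε, hε, hball⟩ := Metric.mem_nhds_iff.1 hpre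
  -- slices of the product ball
  have hmem : ∀ τ ∈ Metric.ball t ε, ∀ y ∈ Metric.ball x ε,
      M < ‖u τ y‖ ∧ τ ∈ Set.Ioo 0 T := by
    intro τ hτ y hy
    have hτy : (τ, y) ∈ Metric.ball (t, x) ε := by
      rw [← ball_prod_same]
      exact ⟨hτ, hy⟩
    have := hball hτy
    exact ⟨this.1, this.2.1⟩
  have hslice : ∀ τ ∈ Metric.ball t ε,
      volume (Metric.ball x ε) ≤ volume {y | M < ‖u τ y‖} :=
    fun τ hτ => measure_mono fun y hy => (hmem τ hτ y hy).1
  have hτT : Metric.ball t ε ⊆ Set.Ioo 0 T :=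
    fun τ hτ => (hmem τ hτ x (Metric.mem_ball_self hε)).2
  -- positive space–time volume below the vanishing one
  have hpos : 0 < ∫⁻ τ in Set.Ioo 0 T, volume {y | M < ‖u τ y‖} :=
    calc (0 : ℝ≥0∞) < volume (Metric.ball x ε) * volume (Metric.ball t ε) :=
          ENNReal.mul_pos (Metric.measure_ball_pos volume x hε).ne'
            (Metric.measure_ball_pos volume t hε).ne'
      _ = ∫⁻ _ in Metric.ball t ε, volume (Metric.ball x ε) := (setLIntegral_const _ _).symm
      _ ≤ ∫⁻ τ in Metric.ball t ε, volume {y | M < ‖u τ y‖} :=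
          setLIntegral_mono' Metric.isOpen_ball.measurableSet hslice
      _ ≤ ∫⁻ τ in Set.Ioo 0 T, volume {y | M < ‖u τ y‖} := lintegral_mono_set hτT
  exact hpos.ne' hV

/-- **Tool (c): ZERO-EXCESS.** If `v` is continuous, `(‖v‖ - c)₊²` is integrable and
`∫ (‖v x‖ - c)₊² ≤ 0`, then `‖v x‖ ≤ c` everywhere: the integrand is nonnegative, continuous and of
zero integral, hence vanishes a.e., hence everywhere (Lebesgue measure charges open sets). -/
theorem tools_zeroExcess :
    ∀ (v : EuclideanSpace ℝ (Fin 3) → EuclideanSpace ℝ (Fin 3)) (c : ℝ), Continuous v →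
      MeasureTheory.Integrable (fun x => (max (‖v x‖ - c) 0) ^ 2) volume →
      ∫ x, (max (‖v x‖ - c) 0) ^ 2 ≤ 0 → ∀ x, ‖v x‖ ≤ c := by
  intro v c hv hint hle x
  have hnn : ∀ y, 0 ≤ (max (‖v y‖ - c) 0) ^ 2 := fun y => sq_nonneg _
  have hzero : ∫ y, (max (‖v y‖ - c) 0) ^ 2 = 0 := le_antisymm hle (integral_nonneg hnn)
  have hae : (fun y => (max (‖v y‖ - c) 0) ^ 2) =ᵐ[volume] 0 :=
    (integral_eq_zero_iff_of_nonneg hnn hint).1 hzero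
  have hcont : Continuous fun y => (max (‖v y‖ - c) 0) ^ 2 :=
    ((hv.norm.sub continuous_const).max continuous_const).pow 2
  have heq : (fun y => (max (‖v y‖ - c) 0) ^ 2) = 0 :=
    (hcont.ae_eq_iff_eq volume continuous_const).1 hae
  have hx : (max (‖v x‖ - c) 0) ^ 2 = 0 := congr_fun heq x
  have hmax : max (‖v x‖ - c) 0 = 0 := (pow_eq_zero_iff two_ne_zero).1 hx
  have hsub : ‖v x‖ - c ≤ 0 := hmax ▸ le_max_left _ _
  linarith

/-- **Stub S4 (level-set tools).** (a) monotone limit in the upper time limit of a lower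
Lebesgue integral over `(0,t)`, `t ↑ T` (no measurability needed); (b) OPEN-NULL-EMPTY: a jointly
continuous field whose super-level set `{|u| > M}` has zero space–time volume never exceeds `M` on
`(0,T)`; (c) ZERO-EXCESS: a continuous slice with `∫ (|v|-c)₊² ≤ 0` never exceeds `c`. -/
theorem stub_levelSetTools :
    (∀ (f : ℝ → ℝ≥0∞) (T : ℝ) (r : ℝ≥0∞), 0 < T →
      (∀ t ∈ Set.Ico 0 T, ∫⁻ τ in Set.Ioo 0 t, f τ ≤ r) → ∫⁻ τ in Set.Ioo 0 T, f τ ≤ r) ∧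
    (∀ (T M : ℝ) (u : ℝ → EuclideanSpace ℝ (Fin 3) → EuclideanSpace ℝ (Fin 3)),
      ContinuousOn (Function.uncurry u) (Set.Ico 0 T ×ˢ Set.univ) →
      (∫⁻ τ in Set.Ioo 0 T, volume {x | M < ‖u τ x‖}) = 0 →
      ∀ t ∈ Set.Ioo 0 T, ∀ x, ‖u t x‖ ≤ M) ∧
    (∀ (v : EuclideanSpace ℝ (Fin 3) → EuclideanSpace ℝ (Fin 3)) (c : ℝ), Continuous v →
      MeasureTheory.Integrable (fun x => (max (‖v x‖ - c) 0) ^ 2) volume →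
      ∫ x, (max (‖v x‖ - c) 0) ^ 2 ≤ 0 → ∀ x, ‖v x‖ ≤ c) :=
  ⟨tools_supLimit, tools_openNullEmpty, tools_zeroExcess⟩

end Summit.NavierStokesRegularity.NavierStokesRegularity.Theorems.LevelSetClosure
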